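import Literature.Analysis.PDE.HsEval
import HarnessLib

/-!
# Level bookkeeping and the `H^s` pairing through continuous representatives

Function-space layer of the energy-method programme for short-time existence of quasilinear
strictly parabolic second-order systems on a closed manifold (hypothesis `hQL` of
`Literature.Geometry.Riemannian.ricciFlow_shortTime_existence_of_quasilinear`). The Galerkin
operator of that programme is given in DUALITY FORM (Kato–Lai 1984, §3, the canonical triplet
`V ⊂ H ⊂ V*`, tree file `FluidPDE/KatoLaiCanonicalTriplet.lean`): for `U ∈ H = 𝐇_s` and
`v ∈ V = 𝐇_{s+d}`, `d = s + dim + 2`, the value `B(U)(v)` is the `L²` pairing of a continuous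
compactly supported field (the nonlinear operator applied to the continuous representative of
`U`) with `Λ_s v_k = Σ_w (-1)^{|w|} ∂_w ∂_w v_k`, the word form of `(1 - Δ)^s v_k`, read through
the point evaluations of `HsEval.lean`. This file supplies:

* `OWord.snocEquiv` — words of length `s + 1` are words of length `s` with one more letter;
  `norm_jetL_succ_sq`: `‖jetL (s+1) u‖² = ‖jetL s u‖² + Σ_{k,w,i} ‖∂_w ∂_i u_k‖²_{L²}` — the level
  `s + 1` norm is the level `s` norm plus the "gradient energy" that Gårding's inequality
  produces;
* `LamFun s g = Σ_w (-1)^{|red w|} ∂_w ∂_w g` and `inner_jetL_eq_sum_integral_LamFun`: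
  `⟪jetL s v, jetL s u⟫ = Σ_k ∫ ⟪Λ_s v_k, u_k⟫` (all derivatives on the smooth side);
* `rep_ae_eq_comp` — the continuous representative `rep k U` of `U ∈ 𝐇_s` IS the bottom `L²`
  component a.e., whence `inner_jetL_eq_sum_integral_LamFun_rep`:
  `⟪jetL s v, U⟫ = Σ_k ∫ ⟪Λ_s v_k, rep k U⟫` for every `U ∈ 𝐇_s` (`dim ≤ s`);
* `Hs.lamEv k y : 𝐇_{s+d} →L W`, `lamEv k y v = (Λ_s (rep k v))(y)`, and the **pairing functional**
  `Hs.pairL k F : 𝐇_{s+d} →L ℝ`, `pairL k F v = ∫ ⟪Λ_s (rep k v), F⟫` for a continuous compactly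
  supported field `F`, with the bound `|pairL k F v| ≤ C ‖v‖ ∫ ‖F‖` (`C` uniform for supports
  in a fixed ball) and its value on smooth jets with a smooth `F`,
  `pairL k F (jetH φ) = Σ_w ∫ ⟪∂_w φ_k, ∂_w F⟫` (integration by parts back) — the form in which
  Gårding's inequality is computed.

Everything is proved; no named fact and no `sorry` is introduced.

## References

* T. Kato, C. Y. Lai, Nonlinear evolution equations and the Euler flow, J. Funct. Anal. 56
  (1984) 15–28, §3 (canonical triplet, duality pairing). [KatoLai1984]
* R. A. Adams, *Sobolev Spaces*, Academic Press 1975, ¶3.1. [Adams1975]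
-/

noncomputable section

open MeasureTheory Set Function Filter Metric
open scoped ContDiff Topology RealInnerProductSpace ENNReal NNReal

namespace Literature.Analysis.PDE

open Literature.Analysis.FunctionSpaces

variable {ι : Type*} [Fintype ι] [DecidableEq ι]

/-! ### Words of length `s + 1` -/

namespace OWord

variable {s : ℕ}

omit [Fintype ι] [DecidableEq ι] in
/-- Append one letter. [folklore] -/
def snoc (w : OWord ι s) (o : Option ι) : OWord ι (s + 1) :=
  ⟨w.1 ++ [o], List.length_append.trans (congrArg (· + [o].length) w.2)⟩

omit [Fintype ι] [DecidableEq ι] in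
/-- The underlying list of `snoc`. [folklore] -/
@[simp]
theorem snoc_val (w : OWord ι s) (o : Option ι) : (w.snoc o).1 = w.1 ++ [o] := rfl

omit [Fintype ι] [DecidableEq ι] in
/-- Reduction of `snoc w none`. [folklore] -/
@[simp]
theorem red_snoc_none (w : OWord ι s) : (w.snoc none).red = w.red := by
  simp [red, snoc, List.reduceOption_append]

omit [Fintype ι] [DecidableEq ι] in
/-- Reduction of `snoc w (some i)`. [folklore] -/
@[simp]
theorem red_snoc_some (w : OWord ι s) (i : ι) : (w.snoc (some i)).red = w.red ++ [i] := by
  simp [red, snoc, List.reduceOption_append, List.reduceOption_cons_of_some]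

/-- **Words of length `s + 1` are words of length `s` with one more letter.** [folklore] -/
def snocEquiv : OWord ι s × Option ι ≃ OWord ι (s + 1) where
  toFun p := p.1.snoc p.2
  invFun w := (⟨w.1.dropLast, by simp [w.2]⟩, w.1.getLast (by
    intro h; have := w.2; rw [h] at this; simp at this))
  left_inv p := by
    obtain ⟨w, o⟩ := p
    refine Prod.ext (Subtype.ext ?_) ?_
    · simp [snoc]
    · simp [snoc]
  right_inv w := by
    refine Subtype.ext ?_
    simp only [snoc]
    exact List.dropLast_append_getLast _

omit [DecidableEq ι] in
/-- Sums over words of length `s + 1`. [folklore] -/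
theorem sum_succ {M : Type*} [AddCommMonoid M] (f : OWord ι (s + 1) → M) :
    ∑ w : OWord ι (s + 1), f w = ∑ w : OWord ι s, ∑ o : Option ι, f (w.snoc o) := by
  rw [← Fintype.sum_prod_type']
  exact (Fintype.sum_equiv snocEquiv (fun p => f (p.1.snoc p.2)) f fun p => rfl).symm

end OWord

/-! ### The level `s + 1` norm -/

section Levels

variable {W : Type*} [NormedAddCommGroup W] [InnerProductSpace ℝ W]
variable {N s : ℕ}

omit [DecidableEq ι] in
/-- **`‖jetL (s+1) u‖² = ‖jetL s u‖² + Σ_{k,w,i} ‖∂_w ∂_i u_k‖²_{L²}`** (the last letter of a word of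
length `s + 1` is either `none` or a coordinate). [cite: Adams1975, ¶3.1] -/
theorem norm_jetL_succ_sq (u : smoothCS W N ι) :
    ‖jetL (s + 1) u‖ ^ 2 = ‖jetL s u‖ ^ 2 + ∑ p : Fin N × OWord ι s, ∑ i : ι,
      ∫ x, ‖cwd p.2.red (cwd [i] (u.1 p.1)) x‖ ^ 2 := by
  have h1 : ∀ (k : Fin N) (w : OWord ι s),
      ∑ o : Option ι, ∫ x, ‖owd (w.snoc o) (u.1 k) x‖ ^ 2 ∂(volume : Measure (EuclideanSpace ℝ ι)) =
        (∫ x, ‖owd w (u.1 k) x‖ ^ 2) + ∑ i : ι, ∫ x, ‖cwd w.red (cwd [i] (u.1 k)) x‖ ^ 2 := by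
    intro k w
    rw [Fintype.sum_option]
    congr 1
    · rw [owd_def, owd_def, OWord.red_snoc_none]
    · refine Finset.sum_congr rfl fun i _ => ?_
      rw [owd_def, OWord.red_snoc_some, cwd_append_singleton]
      rfl
  have hL : ‖jetL (s + 1) u‖ ^ 2 = ∑ k : Fin N, ∑ w : OWord ι s,
      ((∫ x, ‖owd w (u.1 k) x‖ ^ 2) + ∑ i : ι, ∫ x, ‖cwd w.red (cwd [i] (u.1 k)) x‖ ^ 2) := by
    rw [norm_jetL_sq, Fintype.sum_prod_type]
    refine Finset.sum_congr rfl fun k _ => ?_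
    rw [OWord.sum_succ]
    exact Finset.sum_congr rfl fun w _ => h1 k w
  have hR0 : ‖jetL s u‖ ^ 2 = ∑ k : Fin N, ∑ w : OWord ι s, ∫ x, ‖owd w (u.1 k) x‖ ^ 2 := by
    rw [norm_jetL_sq, Fintype.sum_prod_type]
  have hR1 : ∑ p : Fin N × OWord ι s, ∑ i : ι, ∫ x, ‖cwd p.2.red (cwd [i] (u.1 p.1)) x‖ ^ 2 =
      ∑ k : Fin N, ∑ w : OWord ι s, ∑ i : ι, ∫ x, ‖cwd w.red (cwd [i] (u.1 k)) x‖ ^ 2 :=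
    Fintype.sum_prod_type _
  rw [hL, hR0, hR1, ← Finset.sum_add_distrib]
  refine Finset.sum_congr rfl fun k _ => ?_
  rw [Finset.sum_add_distrib]

omit [DecidableEq ι] in
/-- **The gradient energy is the gap between consecutive levels** (outermost-derivative form,
by Schwarz): `Σ_{k,w,i} ‖∂_i ∂_w u_k‖²_{L²} = ‖jetL (s+1) u‖² - ‖jetL s u‖²`. [cite: Adams1975, ¶3.1] -/
theorem sum_integral_norm_cwd_cons_sq (u : smoothCS W N ι) :
    (∑ p : Fin N × OWord ι s, ∑ i : ι, ∫ x, ‖cwd (i :: p.2.red) (u.1 p.1) x‖ ^ 2 : ℝ) =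
      ‖jetL (s + 1) u‖ ^ 2 - ‖jetL s u‖ ^ 2 := by
  rw [norm_jetL_succ_sq, add_sub_cancel_left]
  refine Finset.sum_congr rfl fun p _ => Finset.sum_congr rfl fun i _ => ?_
  refine integral_congr_ae (Eventually.of_forall fun x => ?_)
  have h := congrFun (cwd_cons_eq_cwd_fderiv (u.2 p.1).1 i p.2.red) x
  change ‖cwd (i :: p.2.red) (u.1 p.1) x‖ ^ 2 = ‖cwd p.2.red (cwd [i] (u.1 p.1)) x‖ ^ 2
  rw [h, cwd_singleton]

omit [DecidableEq ι] in
/-- Restriction does not increase the norm: `‖restrictLp d U‖ ≤ ‖U‖`. [folklore] -/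
theorem norm_restrictLp_le (d : ℕ) (U : L2Jet W N (s + d) ι) : ‖restrictLp d U‖ ≤ ‖U‖ := by
  have h1 : ‖restrictVal (W := W) (N := N) (ι := ι) (s := s) d‖ ≤ 1 :=
    ContinuousLinearMap.opNorm_le_bound _ zero_le_one fun t => by
      rw [one_mul]; exact norm_restrictValₗ_le d t
  have h2 : ‖restrictLp (W := W) (N := N) (ι := ι) (s := s) d‖ ≤ 1 :=
    (ContinuousLinearMap.norm_compLpL_le (p := 2) (μ := (volume : Measure (EuclideanSpace ℝ ι)))
      (restrictVal (W := W) (N := N) (ι := ι) (s := s) d)).trans h1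
  have h3 := ContinuousLinearMap.le_opNorm (restrictLp (W := W) (N := N) (ι := ι) (s := s) d) U
  calc ‖restrictLp d U‖ ≤ ‖restrictLp (W := W) (N := N) (ι := ι) (s := s) d‖ * ‖U‖ := h3
    _ ≤ 1 * ‖U‖ := mul_le_mul_of_nonneg_right h2 (norm_nonneg _)
    _ = ‖U‖ := one_mul _

omit [DecidableEq ι] in
/-- `‖Hs.restrict d U‖ ≤ ‖U‖`. [folklore] -/
theorem norm_restrict_le (d : ℕ) (U : Hs W N (s + d) ι) : ‖Hs.restrict d U‖ ≤ ‖U‖ := by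
  change ‖(Hs.restrict d U : L2Jet W N s ι)‖ ≤ ‖(U : L2Jet W N (s + d) ι)‖
  rw [coe_restrict]
  exact norm_restrictLp_le d _

end Levels

/-! ### `Λ_s` in word form and the pairing identities on smooth jets -/

section Lam

variable {W : Type*} [NormedAddCommGroup W] [InnerProductSpace ℝ W]
variable {N : ℕ}

/-- **`Λ_s g = Σ_w (-1)^{|red w|} ∂_w ∂_w g`**, the word form of `(1 - Δ)^s g`. [cite: Adams1975, ¶3.1] -/
def LamFun (s : ℕ) (g : EuclideanSpace ℝ ι → W) : EuclideanSpace ℝ ι → W :=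
  fun y => ∑ w : OWord ι s, ((-1 : ℝ) ^ w.red.length) • cwd w.red (cwd w.red g) y

omit [DecidableEq ι] in
/-- Unfolding. [folklore] -/
theorem LamFun_apply (s : ℕ) (g : EuclideanSpace ℝ ι → W) (y : EuclideanSpace ℝ ι) :
    LamFun s g y = ∑ w : OWord ι s, ((-1 : ℝ) ^ w.red.length) • cwd w.red (cwd w.red g) y := rfl

omit [DecidableEq ι] in
/-- `Λ_s g` is continuous for smooth `g`. [folklore] -/
theorem continuous_LamFun (s : ℕ) {g : EuclideanSpace ℝ ι → W} (hg : ContDiff ℝ ∞ g) :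
    Continuous (LamFun s g) :=
  continuous_finsetSum _ fun _ _ => (continuous_cwd (contDiff_cwd hg _) _).const_smul _

omit [DecidableEq ι] in
/-- `Λ_s g` has compact support if `g` has. [folklore] -/
theorem hasCompactSupport_LamFun (s : ℕ) {g : EuclideanSpace ℝ ι → W} (hg : HasCompactSupport g) :
    HasCompactSupport (LamFun s g) := by
  refine HasCompactSupport.of_support_subset_isCompact hg ?_
  intro y hy
  rw [mem_support] at hy
  by_contra hyg
  apply hy
  rw [LamFun_apply]
  refine Finset.sum_eq_zero fun w _ => ?_
  have h : cwd w.red (cwd w.red g) y = 0 := by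
    rw [← cwd_append]
    exact image_eq_zero_of_notMem_tsupport fun h => hyg (tsupport_cwd_subset _ g h)
  rw [h, smul_zero]

omit [DecidableEq ι] in
/-- **All derivatives on the smooth side**: `⟪jetL s v, jetL s u⟫ = Σ_k ∫ ⟪Λ_s v_k, u_k⟫`.
[cite: Adams1975, ¶3.1] -/
theorem inner_jetL_eq_sum_integral_LamFun {s : ℕ} (v u : smoothCS W N ι) :
    ⟪jetL s v, jetL s u⟫ = ∑ k : Fin N, ∫ y, ⟪LamFun s (v.1 k) y, u.1 k y⟫ := by
  rw [inner_jetL_jetL, Fintype.sum_prod_type]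
  refine Finset.sum_congr rfl fun k _ => ?_
  have hint : ∀ w : OWord ι s, Integrable (fun y =>
      ⟪((-1 : ℝ) ^ w.red.length) • cwd w.red (cwd w.red (v.1 k)) y, u.1 k y⟫)
      (volume : Measure (EuclideanSpace ℝ ι)) := fun w =>
    integrable_inner_of_hasCompactSupport
      ((continuous_cwd (contDiff_cwd (v.2 k).1 _) _).const_smul _) (u.2 k).1.continuous
      (Or.inr (u.2 k).2)
  have hsum : (fun y => ⟪LamFun s (v.1 k) y, u.1 k y⟫) = fun y =>
      ∑ w : OWord ι s, ⟪((-1 : ℝ) ^ w.red.length) • cwd w.red (cwd w.red (v.1 k)) y, u.1 k y⟫ := by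
    funext y; rw [LamFun_apply, sum_inner]
  rw [hsum, integral_finsetSum _ fun w _ => hint w]
  refine Finset.sum_congr rfl fun w _ => ?_
  have hcomm : (fun x => ⟪owd w (v.1 k) x, owd w (u.1 k) x⟫) =
      fun x => ⟪cwd w.red (u.1 k) x, cwd w.red (v.1 k) x⟫ := by
    funext x; rw [owd_def, owd_def, real_inner_comm]
  have hsmul : (fun y => ⟪((-1 : ℝ) ^ w.red.length) • cwd w.red (cwd w.red (v.1 k)) y, u.1 k y⟫) =
      fun y => ((-1 : ℝ) ^ w.red.length) * ⟪u.1 k y, cwd w.red (cwd w.red (v.1 k)) y⟫ := by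
    funext y; rw [real_inner_smul_left, real_inner_comm]
  change ∫ x, ⟪owd w (v.1 k) x, owd w (u.1 k) x⟫ = _
  rw [hcomm, hsmul, integral_const_mul]
  exact integral_inner_cwd_cwd_eq (u.2 k).1 (v.2 k).1 (Or.inl (u.2 k).2) w.red

end Lam

/-! ### The continuous representative is the bottom component -/

section RepComp

variable {W : Type*} [NormedAddCommGroup W] [InnerProductSpace ℝ W] [CompleteSpace W]
variable {N s : ℕ}

/-- The bottom-component extraction `𝐇_s → L²(ℝⁿ; W)` as a continuous linear map. [folklore] -/
def Hs.compLp (k : Fin N) : Hs W N s ι →L[ℝ] Lp W 2 (volume : Measure (EuclideanSpace ℝ ι)) :=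
  ((PiLp.proj 2 (𝕜 := ℝ) (fun _ : Fin N × OWord ι s => W) (k, OWord.zero ι s)).compLpL 2
    (volume : Measure (EuclideanSpace ℝ ι))).comp (Hs W N s ι).subtypeL

omit [DecidableEq ι] [CompleteSpace W] in
/-- Pointwise a.e. form of `compLp`. [folklore] -/
theorem coeFn_compLp (k : Fin N) (U : Hs W N s ι) :
    (Hs.compLp k U : EuclideanSpace ℝ ι → W) =ᵐ[volume]
      fun y => ((U : L2Jet W N s ι) : EuclideanSpace ℝ ι → JetVal W N s ι) y (k, OWord.zero ι s) := by
  refine (ContinuousLinearMap.coeFn_compLpL _ _).trans (Eventually.of_forall fun y => ?_)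
  rfl

omit [DecidableEq ι] [CompleteSpace W] in
/-- On smooth jets the bottom component is the function itself, a.e. [folklore] -/
theorem coeFn_compLp_jetH (k : Fin N) (u : smoothCS W N ι) :
    (Hs.compLp k (jetH s u) : EuclideanSpace ℝ ι → W) =ᵐ[volume] u.1 k := by
  refine (coeFn_compLp k (jetH s u)).trans ?_
  filter_upwards [coeFn_jetL (s := s) u] with y hy
  rw [coe_jetH, hy]
  simp

/-- **The continuous representative is the bottom `L²` component a.e.** (`dim ≤ s`).
[cite: Adams1975, ¶3.1] -/
theorem rep_ae_eq_comp {k : Fin N} (hs : Fintype.card ι ≤ s) (U : Hs W N s ι) :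
    (fun y => Hs.rep k U y) =ᵐ[volume]
      fun y => ((U : L2Jet W N s ι) : EuclideanSpace ℝ ι → JetVal W N s ι) y (k, OWord.zero ι s) := by
  obtain ⟨u, hu⟩ := exists_seq_tendsto_jetH U
  -- `L²` convergence of the bottom components, hence a.e. convergence along a subsequence
  have hL2 : Tendsto (fun n => Hs.compLp k (jetH s (u n))) atTop (𝓝 (Hs.compLp k U)) :=
    ((Hs.compLp (W := W) (s := s) k).continuous.tendsto U).comp hu
  have hmeas : TendstoInMeasure volume
      (fun n => (Hs.compLp k (jetH s (u n)) : EuclideanSpace ℝ ι → W)) atTop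
      (Hs.compLp k U : EuclideanSpace ℝ ι → W) :=
    tendstoInMeasure_of_tendsto_Lp hL2
  obtain ⟨ns, hns, hae⟩ := hmeas.exists_seq_tendsto_ae
  -- pointwise convergence of the representatives everywhere
  have hpt : ∀ y, Tendsto (fun n => (u (ns n)).1 k y) atTop (𝓝 (Hs.rep k U y)) := by
    intro y
    have h1 : Tendsto (fun n => Hs.rep k (jetH s (u (ns n))) y) atTop (𝓝 (Hs.rep k U y)) := by
      have hc : Continuous fun V : Hs W N s ι => Hs.rep k V y := (Hs.ev k [] y).continuous
      exact (hc.tendsto U).comp (hu.comp hns.tendsto_atTop)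
    refine h1.congr fun n => ?_
    rw [rep_jetH hs]
  -- compare along the subsequence
  have hjet : ∀ n, (Hs.compLp k (jetH s (u (ns n))) : EuclideanSpace ℝ ι → W) =ᵐ[volume]
      (u (ns n)).1 k := fun n => coeFn_compLp_jetH k _
  have hall := (ae_all_iff (μ := (volume : Measure (EuclideanSpace ℝ ι)))).2 hjet
  filter_upwards [hae, hall, coeFn_compLp k U] with y hy hy' hyU
  have h2 : Tendsto (fun n => (u (ns n)).1 k y) atTop
      (𝓝 ((Hs.compLp k U : EuclideanSpace ℝ ι → W) y)) :=
    hy.congr fun n => by rw [hy' n]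
  rw [← hyU]
  exact tendsto_nhds_unique (hpt y) h2

/-- **The `H^s` pairing of a smooth jet with `U ∈ 𝐇_s` through the representative**:
`⟪jetL s v, U⟫ = Σ_k ∫ ⟪Λ_s v_k, rep k U⟫` (`dim ≤ s`). [cite: Adams1975, ¶3.1] -/
theorem inner_jetL_eq_sum_integral_LamFun_rep (hs : Fintype.card ι ≤ s) (v : smoothCS W N ι)
    (U : Hs W N s ι) :
    ⟪jetL s v, (U : L2Jet W N s ι)⟫ = ∑ k : Fin N, ∫ y, ⟪LamFun s (v.1 k) y, Hs.rep k U y⟫ := by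
  rw [inner_jetL_of_mem_Hs v U.2, Fintype.sum_prod_type]
  refine Finset.sum_congr rfl fun k _ => ?_
  have hrep := rep_ae_eq_comp (k := k) hs U
  have hint : ∀ w : OWord ι s, Integrable (fun y =>
      ⟪((-1 : ℝ) ^ w.red.length) • cwd w.red (cwd w.red (v.1 k)) y, Hs.rep k U y⟫)
      (volume : Measure (EuclideanSpace ℝ ι)) := fun w =>
    integrable_inner_of_hasCompactSupport
      ((continuous_cwd (contDiff_cwd (v.2 k).1 _) _).const_smul _)
      (continuous_evFun (by simpa using hs) U)
      (Or.inl ((hasCompactSupport_cwd (hasCompactSupport_cwd (v.2 k).2 w.red) w.red).smul_left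
        (f := fun _ : EuclideanSpace ℝ ι => ((-1 : ℝ) ^ w.red.length))))
  have hsum : (fun y => ⟪LamFun s (v.1 k) y, Hs.rep k U y⟫) = fun y =>
      ∑ w : OWord ι s, ⟪((-1 : ℝ) ^ w.red.length) • cwd w.red (cwd w.red (v.1 k)) y,
        Hs.rep k U y⟫ := by
    funext y; rw [LamFun_apply, sum_inner]
  rw [hsum, integral_finsetSum _ fun w _ => hint w]
  refine Finset.sum_congr rfl fun w _ => ?_
  rw [← integral_const_mul]
  refine integral_congr_ae ?_
  filter_upwards [hrep] with y hy
  rw [real_inner_smul_left, hy, owd_def, owd_def]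

end RepComp

/-! ### The pairing functional -/

section Pair

variable {W : Type*} [NormedAddCommGroup W] [InnerProductSpace ℝ W] [CompleteSpace W]
variable {N s : ℕ}

variable (s) in
/-- The number of spare derivatives of the test space: `d = s + dim + 2`, `V = 𝐇_{s+d}`.
[folklore] -/
def dd (ι : Type*) [Fintype ι] : ℕ := s + Fintype.card ι + 2

omit [DecidableEq ι] in
/-- Words of the form `w.red ++ w.red`, `|w| = s`, are short enough: `2s + dim ≤ s + d`.
[folklore] -/
theorem length_red_append_red_le (w : OWord ι s) :
    (w.red ++ w.red).length + Fintype.card ι ≤ s + dd s ι := by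
  have := w.length_red_le
  simp [dd]; omega

/-- **`Λ_s` through point evaluations**: `lamEv k y v = Σ_w (-1)^{|red w|} ev k (red w ++ red w) y v`,
a continuous linear map `𝐇_{s+d} →L W`, equal to `(Λ_s (rep k v))(y)`. [folklore] -/
def Hs.lamEv (k : Fin N) (y : EuclideanSpace ℝ ι) : Hs W N (s + dd s ι) ι →L[ℝ] W :=
  ∑ w : OWord ι s, ((-1 : ℝ) ^ w.red.length) • Hs.ev k (w.red ++ w.red) y

/-- `lamEv k y v = (Λ_s (rep k v))(y)`. [folklore] -/
theorem lamEv_apply (k : Fin N) (y : EuclideanSpace ℝ ι) (v : Hs W N (s + dd s ι) ι) :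
    Hs.lamEv k y v = LamFun s (Hs.rep k v) y := by
  rw [Hs.lamEv, LamFun_apply]
  simp only [FunLike.coe_sum, Finset.sum_apply, FunLike.coe_smul, Pi.smul_apply]
  refine Finset.sum_congr rfl fun w _ => ?_
  congr 1
  rw [← cwd_append, cwd_rep v (w.red ++ w.red) (length_red_append_red_le w)]
  rfl

/-- `y ↦ lamEv k y v` is continuous. [folklore] -/
theorem continuous_lamEv_apply (k : Fin N) (v : Hs W N (s + dd s ι) ι) :
    Continuous fun y => Hs.lamEv k y v := by
  have h : (fun y => Hs.lamEv k y v) = fun y =>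
      ∑ w : OWord ι s, ((-1 : ℝ) ^ w.red.length) • Hs.evFun k (w.red ++ w.red) v y := by
    funext y
    simp [Hs.lamEv, evFun_apply]
  rw [h]
  exact continuous_finsetSum _ fun w _ =>
    (continuous_evFun (length_red_append_red_le w) v).const_smul _

/-- On smooth jets: `lamEv k y (jetH φ) = (Λ_s φ_k)(y)`. [folklore] -/
theorem lamEv_jetH (k : Fin N) (y : EuclideanSpace ℝ ι) (φ : smoothCS W N ι) :
    Hs.lamEv k y (jetH (s + dd s ι) φ) = LamFun s (φ.1 k) y := by
  rw [lamEv_apply, rep_jetH (by simp [dd]; omega)]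

/-- **Uniform operator-norm bound for `lamEv` on balls.** [folklore] -/
theorem exists_norm_lamEv_le {R : ℝ} (hR : 0 < R) :
    ∃ C : ℝ, 0 ≤ C ∧ ∀ (k : Fin N), ∀ y ∈ closedBall (0 : EuclideanSpace ℝ ι) R,
      ∀ v : Hs W N (s + dd s ι) ι, ‖Hs.lamEv k y v‖ ≤ C * ‖v‖ := by
  obtain ⟨C, hC0, hC⟩ := exists_norm_ev_le (W := W) (N := N) (ι := ι) (s := s + dd s ι)
    (m := s + s) (by simp [dd]; omega) hR
  refine ⟨Fintype.card (OWord ι s) * C, by positivity, fun k y hy v => ?_⟩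
  rw [Hs.lamEv]
  simp only [FunLike.coe_sum, Finset.sum_apply, FunLike.coe_smul, Pi.smul_apply]
  refine (norm_sum_le _ _).trans ?_
  calc ∑ w : OWord ι s, ‖((-1 : ℝ) ^ w.red.length) • Hs.ev k (w.red ++ w.red) y v‖
      ≤ ∑ _w : OWord ι s, C * ‖v‖ := by
        refine Finset.sum_le_sum fun w _ => ?_
        rw [norm_smul, norm_pow, norm_neg, norm_one, one_pow, one_mul]
        exact hC k (w.red ++ w.red) (by have := w.length_red_le; simp; omega) y hy v
    _ = Fintype.card (OWord ι s) * C * ‖v‖ := by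
        rw [Finset.sum_const, nsmul_eq_mul, Finset.card_univ]; ring

/-- Integrability of the pairing integrand. [folklore] -/
theorem integrable_inner_lamEv (k : Fin N) (v : Hs W N (s + dd s ι) ι)
    {F : EuclideanSpace ℝ ι → W} (hF : Continuous F) (hFc : HasCompactSupport F) :
    Integrable (fun y => ⟪Hs.lamEv k y v, F y⟫) (volume : Measure (EuclideanSpace ℝ ι)) :=
  integrable_inner_of_hasCompactSupport (continuous_lamEv_apply k v) hF (Or.inr hFc)

/-- The pairing `v ↦ ∫ ⟪Λ_s (rep k v), F⟫` as a linear map. [folklore] -/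
def pairₗ (k : Fin N) {F : EuclideanSpace ℝ ι → W} (hF : Continuous F) (hFc : HasCompactSupport F) :
    Hs W N (s + dd s ι) ι →ₗ[ℝ] ℝ where
  toFun v := ∫ y, ⟪Hs.lamEv k y v, F y⟫
  map_add' v v' := by
    rw [← integral_add (integrable_inner_lamEv k v hF hFc) (integrable_inner_lamEv k v' hF hFc)]
    refine integral_congr_ae (Eventually.of_forall fun y => ?_)
    simp only [map_add, inner_add_left]
  map_smul' c v := by
    rw [RingHom.id_apply, ← integral_smul]
    refine integral_congr_ae (Eventually.of_forall fun y => ?_)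
    change ⟪Hs.lamEv k y (c • v), F y⟫ = c • ⟪Hs.lamEv k y v, F y⟫
    rw [map_smul, real_inner_smul_left, smul_eq_mul]

/-- **The pairing functional `pairL k F : 𝐇_{s+d} →L ℝ`**, `pairL k F v = ∫ ⟪Λ_s (rep k v), F⟫`,
with the bound `|pairL k F v| ≤ C_R ‖v‖ ∫ ‖F‖` for `tsupport F` in the closed ball of radius `R`.
[cite: KatoLai1984, §3 (p. 18)] -/
def Hs.pairL (k : Fin N) {F : EuclideanSpace ℝ ι → W} (hF : Continuous F)
    (hFc : HasCompactSupport F) : Hs W N (s + dd s ι) ι →L[ℝ] ℝ :=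
  (pairₗ k hF hFc).mkContinuous
    (Classical.choose (exists_norm_lamEv_le (W := W) (N := N) (s := s) (ι := ι)
      (R := (Classical.choose (hFc.isCompact.isBounded.subset_closedBall_lt 0 0)))
        (Classical.choose_spec (hFc.isCompact.isBounded.subset_closedBall_lt 0 0)).1) *
      ∫ y, ‖F y‖) fun v => by
    set hb := hFc.isCompact.isBounded.subset_closedBall_lt 0 0 with hbdef
    set R := Classical.choose hb with hRdef
    have hR : 0 < R := (Classical.choose_spec hb).1
    have hsub : tsupport F ⊆ closedBall (0 : EuclideanSpace ℝ ι) R := (Classical.choose_spec hb).2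
    set hC := exists_norm_lamEv_le (W := W) (N := N) (s := s) (ι := ι) hR with hCdef
    set C := Classical.choose hC
    have hC0 : 0 ≤ C := (Classical.choose_spec hC).1
    have hCb := (Classical.choose_spec hC).2
    change |∫ y, ⟪Hs.lamEv k y v, F y⟫| ≤ C * (∫ y, ‖F y‖) * ‖v‖
    have hpt : ∀ y, ‖⟪Hs.lamEv k y v, F y⟫‖ ≤ C * ‖v‖ * ‖F y‖ := by
      intro y
      by_cases hy : y ∈ tsupport F
      · calc ‖⟪Hs.lamEv k y v, F y⟫‖ ≤ ‖Hs.lamEv k y v‖ * ‖F y‖ := norm_inner_le_norm _ _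
          _ ≤ C * ‖v‖ * ‖F y‖ :=
            mul_le_mul_of_nonneg_right (hCb k y (hsub hy) v) (norm_nonneg _)
      · rw [image_eq_zero_of_notMem_tsupport hy, inner_zero_right, norm_zero]
        positivity
    rw [← Real.norm_eq_abs]
    calc ‖∫ y, ⟪Hs.lamEv k y v, F y⟫‖ ≤ ∫ y, C * ‖v‖ * ‖F y‖ :=
          norm_integral_le_of_norm_le ((hF.norm.integrable_of_hasCompactSupport hFc.norm).const_mul _)
            (Eventually.of_forall hpt)
      _ = C * ‖v‖ * ∫ y, ‖F y‖ := integral_const_mul _ _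
      _ = C * (∫ y, ‖F y‖) * ‖v‖ := by ring

/-- Value of `pairL`. [folklore] -/
theorem pairL_apply (k : Fin N) {F : EuclideanSpace ℝ ι → W} (hF : Continuous F)
    (hFc : HasCompactSupport F) (v : Hs W N (s + dd s ι) ι) :
    Hs.pairL k hF hFc v = ∫ y, ⟪Hs.lamEv k y v, F y⟫ := rfl

/-- Value of `pairL` through the representative: `pairL k F v = ∫ ⟪Λ_s (rep k v), F⟫`.
[folklore] -/
theorem pairL_apply' (k : Fin N) {F : EuclideanSpace ℝ ι → W} (hF : Continuous F)
    (hFc : HasCompactSupport F) (v : Hs W N (s + dd s ι) ι) :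
    Hs.pairL k hF hFc v = ∫ y, ⟪LamFun s (Hs.rep k v) y, F y⟫ := by
  rw [pairL_apply]
  exact integral_congr_ae (Eventually.of_forall fun y => by
    change ⟪Hs.lamEv k y v, F y⟫ = ⟪LamFun s (Hs.rep k v) y, F y⟫
    rw [lamEv_apply])

/-- **Uniform bound for the pairing functional**: for `R > 0` there is `C` with
`|pairL k F v| ≤ C ‖v‖ ∫ ‖F‖` whenever `tsupport F ⊆ closedBall 0 R`. [folklore] -/
theorem exists_abs_pairL_le {R : ℝ} (hR : 0 < R) :
    ∃ C : ℝ, 0 ≤ C ∧ ∀ (k : Fin N) {F : EuclideanSpace ℝ ι → W} (hF : Continuous F)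
      (hFc : HasCompactSupport F), tsupport F ⊆ closedBall (0 : EuclideanSpace ℝ ι) R →
      ∀ v : Hs W N (s + dd s ι) ι, |Hs.pairL k hF hFc v| ≤ C * ‖v‖ * ∫ y, ‖F y‖ := by
  obtain ⟨C, hC0, hC⟩ := exists_norm_lamEv_le (W := W) (N := N) (s := s) (ι := ι) hR
  refine ⟨C, hC0, fun k F hF hFc hsub v => ?_⟩
  rw [pairL_apply, ← Real.norm_eq_abs]
  have hpt : ∀ y, ‖⟪Hs.lamEv k y v, F y⟫‖ ≤ C * ‖v‖ * ‖F y‖ := by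
    intro y
    by_cases hy : y ∈ tsupport F
    · calc ‖⟪Hs.lamEv k y v, F y⟫‖ ≤ ‖Hs.lamEv k y v‖ * ‖F y‖ := norm_inner_le_norm _ _
        _ ≤ C * ‖v‖ * ‖F y‖ := mul_le_mul_of_nonneg_right (hC k y (hsub hy) v) (norm_nonneg _)
    · rw [image_eq_zero_of_notMem_tsupport hy, inner_zero_right, norm_zero]
      positivity
  calc ‖∫ y, ⟪Hs.lamEv k y v, F y⟫‖ ≤ ∫ y, C * ‖v‖ * ‖F y‖ :=
        norm_integral_le_of_norm_le ((hF.norm.integrable_of_hasCompactSupport hFc.norm).const_mul _)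
          (Eventually.of_forall hpt)
    _ = C * ‖v‖ * ∫ y, ‖F y‖ := integral_const_mul _ _

omit [DecidableEq ι] [CompleteSpace W] in
/-- Integration by parts back on smooth data: `∫ ⟪Λ_s g, F⟫ = Σ_w ∫ ⟪∂_w g, ∂_w F⟫` for smooth
`g` and smooth compactly supported `F`. [cite: Adams1975, ¶3.1] -/
theorem integral_inner_LamFun_eq {g F : EuclideanSpace ℝ ι → W} (hg : ContDiff ℝ ∞ g)
    (hF : ContDiff ℝ ∞ F) (hFc : HasCompactSupport F) :
    ∫ y, ⟪LamFun s g y, F y⟫ = ∑ w : OWord ι s, ∫ y, ⟪cwd w.red g y, cwd w.red F y⟫ := by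
  have hint : ∀ w : OWord ι s, Integrable (fun y =>
      ⟪((-1 : ℝ) ^ w.red.length) • cwd w.red (cwd w.red g) y, F y⟫)
      (volume : Measure (EuclideanSpace ℝ ι)) := fun w =>
    integrable_inner_of_hasCompactSupport
      ((continuous_cwd (contDiff_cwd hg _) _).const_smul _) hF.continuous (Or.inr hFc)
  have hsum : (fun y => ⟪LamFun s g y, F y⟫) = fun y =>
      ∑ w : OWord ι s, ⟪((-1 : ℝ) ^ w.red.length) • cwd w.red (cwd w.red g) y, F y⟫ := by
    funext y; rw [LamFun_apply, sum_inner]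
  rw [hsum, integral_finsetSum _ fun w _ => hint w]
  refine Finset.sum_congr rfl fun w _ => ?_
  -- `∫ ⟪(-1)^{|w|} ∂_w ∂_w g, F⟫ = (-1)^{|w|} ∫ ⟪∂_w ∂_w g, F⟫ = ∫ ⟪∂_w g, ∂_w F⟫`
  have h1 : ∫ y, ⟪((-1 : ℝ) ^ w.red.length) • cwd w.red (cwd w.red g) y, F y⟫ =
      ((-1 : ℝ) ^ w.red.length) * ∫ y, ⟪cwd w.red (cwd w.red g) y, F y⟫ := by
    rw [← integral_const_mul]
    exact integral_congr_ae (Eventually.of_forall fun y => by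
      change ⟪((-1 : ℝ) ^ w.red.length) • cwd w.red (cwd w.red g) y, F y⟫ = _
      rw [real_inner_smul_left])
  rw [h1, integral_inner_cwd_eq (contDiff_cwd hg _) hF (Or.inr hFc) w.red, ← mul_assoc,
    ← pow_add, ← two_mul, pow_mul]
  simp

/-- **The pairing functional on smooth jets with a smooth field**:
`pairL k F (jetH φ) = Σ_w ∫ ⟪∂_w φ_k, ∂_w F⟫`. [cite: Adams1975, ¶3.1] -/
theorem pairL_jetH_eq (k : Fin N) {F : EuclideanSpace ℝ ι → W} (hF : ContDiff ℝ ∞ F)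
    (hFc : HasCompactSupport F) (φ : smoothCS W N ι) :
    Hs.pairL k hF.continuous hFc (jetH (s + dd s ι) φ) =
      ∑ w : OWord ι s, ∫ y, ⟪cwd w.red (φ.1 k) y, cwd w.red F y⟫ := by
  rw [pairL_apply]
  have h : (fun y => ⟪Hs.lamEv k y (jetH (s + dd s ι) φ), F y⟫) =
      fun y => ⟪LamFun s (φ.1 k) y, F y⟫ := by
    funext y; rw [lamEv_jetH]
  rw [h]
  exact integral_inner_LamFun_eq (φ.2 k).1 hF hFc

/-- **The pairing functional on smooth jets with a merely continuous field equals the `H^s`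
inner product when the field is itself a smooth jet**: for `φ, u` smooth,
`Σ_k pairL k (u_k) (jetH φ) = ⟪jetL s φ, jetL s u⟫`. [cite: KatoLai1984, §3 (p. 18), (3.1)] -/
theorem sum_pairL_jetH_eq_inner (φ u : smoothCS W N ι) :
    ∑ k : Fin N, Hs.pairL k (u.2 k).1.continuous (u.2 k).2 (jetH (s + dd s ι) φ) =
      ⟪jetL s φ, jetL s u⟫ := by
  rw [inner_jetL_eq_sum_integral_LamFun]
  refine Finset.sum_congr rfl fun k _ => ?_
  rw [pairL_apply]
  exact integral_congr_ae (Eventually.of_forall fun y => by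
    change ⟪Hs.lamEv k y (jetH (s + dd s ι) φ), u.1 k y⟫ = ⟪LamFun s (φ.1 k) y, u.1 k y⟫
    rw [lamEv_jetH])

end Pair

end Literature.Analysis.PDE

end
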